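import Mathlib
import Summits.KontsevichZagierPeriods.Zeta5Search.DenomLaw.ThresholdModelDict

/-!
# ζ(5) search — DENOM-LAW: the threshold model, PART II (the level census), part A: level model, coverage criteria

Cell `pub-zeta5`, track DENOM-LAW (K1 typing order item (1), «ThresholdModel port»): denom-engine-d2 g12's kernel-checked scratch module
`denom-law/engine-d2/g12/lean/LevelCensus.lean` PART II (THRESHOLD-X4; Theorem S (i)/(i′) at cell level) filed VERBATIM in four parts
(≤ 400 lines each; split plan THRESHOLD-X4 §2; docstrings added where the scratch file had none) by denom-prover-d1 g5.  Part A of 4 (= 6th file of the port).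
HONEST FRAMING: systematic search; MODEL/structure side — elementary integer arithmetic of the level census; nothing about ζ(5); no γ; no irrationality claim; records in print UNMOVED.
The mathematical header of PART II (the census, what is proved) is the second module docstring of part A (`ThresholdModelCensus.lean`).
-/

namespace Summit.KontsevichZagierPeriods.Zeta5Search.DenomLaw.ThresholdModel.Rho

/-! # PART II — THE LEVEL CENSUS: Theorem S (i)/(i′) at CELL level (denom-engine-d2 g12, scratch typing; NOT a tree filing)

HONEST FRAMING: as Part I — MODEL/structure side, elementary integer arithmetic about which INTEGERS of a residue class
`mod p` lie in the seven Pochhammer blocks `[b_j+1, b₀−b_j+1]` and in the numerator `[1, b₀+1]` of a Brown–Zudilin cell;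
no linear form, no p-adic digit, no kernel value; nothing about ζ(5); no γ; no irrationality claim; records in print UNMOVED.

THE CENSUS (theory-d1 g6 `probe11` / g8 `u2check.census` / g9 `octave.census2`; SELECTION-LAW-PROOF §0–§1, §5).
Fix the cell `b = (b₀; b₁,…,b₇)`, its octave `m ≥ 1` and the prime `p`; `ρ_j = b₀ − 2b_j − (m−1)p`, `R₀ = b₀ − (3m−2)p`.
The integers are parametrised by (LEVEL, CLASS):  `t(ℓ,u) = (b₀ + 2 − u + p(2ℓ − 3m + 2))/2`,  `ℓ ∈ ℤ`,
`u ∈ (−p, p]`, `u ≡ R₀ (mod 2)` (theory-d1's census offset `u = s2_x` of the residue class `x = t(0,u) mod p`;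
`tOf_surj`/`tOf_inj` below: every integer is `t(ℓ,u)` for exactly one such pair, `t(ℓ+1,u) = t(ℓ,u) + p`).
In the DOUBLED POSITION `d = 2t − (b₀+2) = p(2ℓ−3m+2) − u` (`dpos`), block `j` contains `t` iff `|d| ≤ b₀ − 2b_j = (m−1)p + ρ_j`
(`BlockCov`, `tOf_mem_block_iff`) and the numerator contains `t` iff `|d| ≤ b₀ = (3m−2)p + R₀` (`NumCov`, `tOf_mem_num_iff`).
`ord(ℓ,u) = #{j : block j ∋ t(ℓ,u)} − [numerator ∋ t(ℓ,u)]` is the pole order of the cell's rational summand at the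
integer of level `ℓ` of class `u`; the SYMMETRIC pattern `T_m(ℓ)` (`Tsym`: 6 on the pole frame `[m−1, 2m−1]`, −1 on the
zero frame `[0, m−2] ∪ [2m, 3m−2]`, 0 elsewhere) is `ord` of the symmetric cell; the EXCESS `E(ℓ,u) = T_m(ℓ) − ord(ℓ,u)`
is the exponent of `(ζ − (ℓ − (3m−2)/2))` in the class polynomial `P_x = F_x / T_m` — a genuine polynomial iff no level is
OVER-COVERED (`E ≥ 0` at every level = «admissible», probe11's `negexp = numshort = False`).

## What is proved here (kernel-checked), for every `LevelBox p R₀ ρ` (`1 ≤ p`, `0 ≤ R₀ < 3p`, `0 ≤ ρ_j ≤ R₀ + p` — on a deep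
cell these are g11's `box` + the lower point digit, `DeepCell.levelBox`), every octave `m ≥ 1` and every `u ∈ [−p, p]`:
* **THE EXCESS TABLE** (`excess_eq_formula` and the per-region lemmas `excess_lowEdge` … `excess_outside`), ONE formula for ALL `m ≥ 1`:
      E(ℓ,u) = [ℓ = m−1]·L(u) + [ℓ = 2m−1]·R(u) + [ℓ = 3m−1]·n₊(u) + [ℓ = −1]·n₋(u)
               − [ℓ = 0]·[u > R₀] − [ℓ = 3m−2]·[u < −R₀] − [ℓ = m−2]·#{j : ρ_j ≥ 3p+u} − [ℓ = 2m]·#{j : ρ_j ≥ 3p−u}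
  with Part I's `L, R, np, nm, reachL, reachR`.  For `m ≥ 2` the four negative terms sit on zero-frame levels (a numerator
  level missing when `|u| > R₀`, a block poking one level beyond the pole frame when `ρ_j ≥ 3p ∓ u`) = INADMISSIBILITY;
  at `m = 1` the zero frame is empty and the SAME four events land on the levels `0 = m−1`, `1 = 2m−1`, `−1 = m−2`,
  `2 = 2m`: they ARE theory-d1 g10's amendments A2/A1 (SELECTION-LAW-PROOF v3 §5) — one table, no case distinction.
* `excess_nonneg_iff` (`m ≥ 2`): no over-covered level ⟺ `|u| ≤ R₀ ∧ ∀ j, ρ_j < 3p − |u|` (theory-d1's inadmissibility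
  criterion, `amend12.py` 24,910/24,910); `excess_of_admissible` / `excess_m_one`: Theorem S (i) as printed (`m ≥ 2`, admissible)
  and (i′) (`m = 1`, amended exponents `LA, RA, npA, nmA`); `DeepCell.excess_nonneg_m_one`: at `m = 1` every class of a deep
  cell is admissible (from g11's `admissible_m1`).
* **S3a BOOKKEEPING** (`sum_Tsym`, `sum_excess`, `sum_ord`): `Σ_ℓ T_m(ℓ) = 4m + 8`, `Σ_ℓ E(ℓ,u) = δ_A(u)` (Part I's AMENDED
  defect `deltaA`, for EVERY m and every class, admissible or not), hence `Σ_ℓ ord(ℓ,u) = 4m + 8 − δ_A(u)`: the census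
  weight `w_x = Z − N` of theory-d1 (`census2`) is `δ_A(u) + [centre-zero] − (4m+8)` (`ord`/`Tsym` vanish off `[−1, 3m−1]`).
* **THE DICTIONARY** (`tOf`, `two_mul_tOf`, `tOf_mem_block_iff`, `tOf_mem_num_iff`, `tOf_succ`, `tOf_inj`, `tOf_surj`,
  `centreZero_iff`): levels × classes ↔ ℤ, blocks/numerator membership ↔ `BlockCov`/`NumCov`, the centre `(b₀+2)/2` is an
  integer of class `u` iff `u = 0 ∧ m even` or `u = p ∧ m odd` (so theory-d1's centre-zero class is Part I's `centre`
  class on `b₀`-even cells and absent on `b₀`-odd cells — the «266 census-convention cells» of U2-LAW v3 §4 (D)).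
* **MIRROR** (`dpos_mirror`, `excess_mirror`): `E(3m−2−ℓ, −u) = E(ℓ, u)` (S3c at level resolution).
* **COROLLARY (U″-open-3 CLOSED on deep cells)** (`DeepCell.isDominant_iff_isDominantA`, `DeepCell.dominant_admissible`,
  `DeepCell.dominant_excess_nonneg`, `DeepCell.dominant_excess_eq`, `DeepCell.dominant_sum_excess`): on a deep cell the two
  dominance notions of Part I coincide, and every dominant class has, at EVERY octave `m ≥ 1`, no over-covered level, excess
  exactly `L, R, n₊, n₋` at the levels `m−1, 2m−1, 3m−1, −1` (roots `ζ = −m/2, m/2, 3m/2, −3m/2`, all root offsets 0 —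
  Theorem S (i) AS PRINTED, the amendments being void on dominant classes) and 0 elsewhere, and class polynomial of degree
  `Σ_ℓ E = δ_A = δ ≤ 4`, i.e. `4m + 8 − δ` net poles — «δ ≤ 4 and no over-covered level as a lemma on the digit structure
  of D(m) cells» (U2-LAW v3, U″-open-3).
Numerical companions (`denom-law/code/d2g12/`): `census12.py` recomputes `ord` by INTEGER membership on g10's eight
exhaustive deep blocks + F2 (254,896 + 1,143 cells, 4,520,920 + 61,931 classes) and asserts the table, the support, S3a,
the census weight / offset / centre conventions, coverage and the admissibility criterion class by class (ALL classes);
`cross13.py` checks dominant sets, weights, labelled roots (all offsets 0) and flags against theory-d1 g9's own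
`octave.census2` on the same cells.
-/

section LevelModel

/-- doubled position of level `ℓ` of the class `u` relative to the cell centre: `2·t(ℓ,u) − (b₀+2) = p(2ℓ − 3m + 2) − u`. -/
def dpos (p m ℓ u : ℤ) : ℤ := p * (2 * ℓ - 3 * m + 2) - u

/-- block `j` = `[b_j+1, b₀−b_j+1]` (doubled half-length `b₀ − 2b_j = (m−1)p + ρ_j`) contains the integer of level `ℓ` of class `u`. -/
def BlockCov (p m ρ ℓ u : ℤ) : Prop := |dpos p m ℓ u| ≤ (m - 1) * p + ρ

/-- the numerator `[1, b₀+1]` (doubled half-length `b₀ = (3m−2)p + R₀`) contains the integer of level `ℓ` of class `u`. -/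
def NumCov (p m R0 ℓ u : ℤ) : Prop := |dpos p m ℓ u| ≤ (3 * m - 2) * p + R0

/-- `BlockCov` is decidable. -/
instance (p m ρ ℓ u : ℤ) : Decidable (BlockCov p m ρ ℓ u) := inferInstanceAs (Decidable (_ ≤ _))
/-- `NumCov` is decidable. -/
instance (p m R0 ℓ u : ℤ) : Decidable (NumCov p m R0 ℓ u) := inferInstanceAs (Decidable (_ ≤ _))

/-- number of blocks containing the integer of level `ℓ` of class `u`. -/
def nBlocks (p m : ℤ) (r : Fin 7 → ℤ) (ℓ u : ℤ) : ℤ := ∑ j : Fin 7, indic (BlockCov p m (r j) ℓ u)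

/-- `ord(ℓ,u)` = #blocks − [numerator] at the integer `t(ℓ,u)`: the pole order there of the cell's rational summand
`(t+1)_{b₀+1} / Π_j (t+b_j+1)_{b₀−2b_j+1}` read at `t ↦ −t(ℓ,u)` (zeros counted negatively). -/
def ord (p R0 m : ℤ) (r : Fin 7 → ℤ) (ℓ u : ℤ) : ℤ := nBlocks p m r ℓ u - indic (NumCov p m R0 ℓ u)

/-- the symmetric level pattern `T_m`: pole order 6 = 7 − 1 on the pole frame `m−1 ≤ ℓ ≤ 2m−1`, a simple zero on the
zero frame `0 ≤ ℓ ≤ m−2`, `2m ≤ ℓ ≤ 3m−2`, nothing elsewhere. -/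
def Tsym (m ℓ : ℤ) : ℤ :=
  if m - 1 ≤ ℓ ∧ ℓ ≤ 2 * m - 1 then 6 else if (0 ≤ ℓ ∧ ℓ ≤ m - 2) ∨ (2 * m ≤ ℓ ∧ ℓ ≤ 3 * m - 2) then -1 else 0

/-- the EXCESS `E(ℓ,u) = T_m(ℓ) − ord(ℓ,u)` = exponent of the level-`ℓ` root `ζ = ℓ − (3m−2)/2` in the class polynomial. -/
def excess (p R0 m : ℤ) (r : Fin 7 → ℤ) (ℓ u : ℤ) : ℤ := Tsym m ℓ - ord p R0 m r ℓ u

/-- the closed form of the excess table (one formula for every octave `m ≥ 1`). -/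
def excessFormula (p R0 m : ℤ) (r : Fin 7 → ℤ) (ℓ u : ℤ) : ℤ :=
  (if ℓ = m - 1 then L p r u else 0) + (if ℓ = 2 * m - 1 then R p r u else 0)
  + (if ℓ = 3 * m - 1 then np p R0 u else 0) + (if ℓ = -1 then nm p R0 u else 0)
  - (if ℓ = 0 then indic (R0 < u) else 0) - (if ℓ = 3 * m - 2 then indic (u < -R0) else 0)
  - (if ℓ = m - 2 then reachL p r u else 0) - (if ℓ = 2 * m then reachR p r u else 0)

/-- the LEVEL BOX: what the census needs of the cell — `p ≥ 1`, `0 ≤ R₀ < 3p` (numerator digit), `0 ≤ ρ_j` (the box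
inequality `b₀ − 2b_j ≥ (m−1)p`) and `ρ_j ≤ R₀ + p` (the lower point digit `b_j ≥ (m−1)p`).  No sorting, no parity, no deep. -/
structure LevelBox (p R0 : ℤ) (r : Fin 7 → ℤ) : Prop where
  one_le_p : 1 ≤ p
  R0_nonneg : 0 ≤ R0
  R0_lt : R0 < 3 * p
  r_nonneg : ∀ j, 0 ≤ r j
  r_le : ∀ j, r j ≤ R0 + p

/-- a deep cell (Part I) satisfies the level box (g11's `box` + the point digit). -/
theorem DeepCell.levelBox {p R0 : ℤ} {r : Fin 7 → ℤ} (h : DeepCell p R0 r) : LevelBox p R0 r where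
  one_le_p := by linarith [h.three_le_p]
  R0_nonneg := h.R0_bounds.1
  R0_lt := h.box.2.2
  r_nonneg j := by linarith [h.one_le_r j]
  r_le := h.point_hi

/-! ### Cover criteria, level by level (theory-d1's level inequalities, `SelectionTable.lean`, in this notation; lower half
directly, upper half by the mirror `ℓ ↦ 3m−2−ℓ`, `u ↦ −u`) -/

section Criteria
variable {p R0 m ρ ℓ u : ℤ}

/-- The doubled position changes sign under the mirror `(ℓ, u) ↦ (3m − 2 − ℓ, −u)`. -/
theorem dpos_mirror (p m ℓ u : ℤ) : dpos p m (3 * m - 2 - ℓ) (-u) = -dpos p m ℓ u := by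
  unfold dpos; ring

/-- Block coverage is mirror-invariant. -/
theorem blockCov_mirror (p m ρ ℓ u : ℤ) : BlockCov p m ρ (3 * m - 2 - ℓ) (-u) ↔ BlockCov p m ρ ℓ u := by
  unfold BlockCov; rw [dpos_mirror, abs_neg]

/-- Numerator coverage is mirror-invariant. -/
theorem numCov_mirror (p m R0 ℓ u : ℤ) : NumCov p m R0 (3 * m - 2 - ℓ) (-u) ↔ NumCov p m R0 ℓ u := by
  unfold NumCov; rw [dpos_mirror, abs_neg]

/-- below the frame (`ℓ ≤ −2`) nothing covers. -/
theorem cov_below (hp : 1 ≤ p) (hR : R0 < 3 * p) (hρ : ρ ≤ R0 + p) (hm : 1 ≤ m) (hu1 : -p ≤ u) (hℓ : ℓ ≤ -2) :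
    ¬ BlockCov p m ρ ℓ u ∧ ¬ NumCov p m R0 ℓ u := by
  have hpm : p ≤ p * m := by nlinarith
  have hk : p * (2 * ℓ - 3 * m + 2) ≤ p * (-3 * m - 2) := mul_le_mul_of_nonneg_left (by linarith) (by linarith)
  have hd : dpos p m ℓ u ≤ -(3 * (p * m)) - 2 * p - u := by unfold dpos; linarith
  constructor
  · intro h
    have := (abs_le.1 h).1
    nlinarith
  · intro h
    have := (abs_le.1 h).1
    nlinarith

/-- level `−1` (`ζ = −3m/2`): a block reaches it iff `m = 1` and `ρ ≥ 3p + u` (A1); … -/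
theorem blockCov_bottom_iff (hp : 1 ≤ p) (hρ : ρ ≤ R0 + p) (hR : R0 < 3 * p) (hm : 1 ≤ m) (hu1 : -p ≤ u) :
    BlockCov p m ρ (-1) u ↔ (m = 1 ∧ 3 * p + u ≤ ρ) := by
  have e : dpos p m (-1) u = -(3 * (p * m) + u) := by unfold dpos; ring
  have hpm : p ≤ p * m := by nlinarith
  have pos : 0 ≤ 3 * (p * m) + u := by linarith
  unfold BlockCov
  rw [e, abs_neg, abs_of_nonneg pos]
  constructor
  · intro h
    by_cases h1 : m = 1
    · subst h1; constructor
      · rfl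
      · linarith
    · have hm2 : 2 ≤ m := by omega
      have : 2 * p ≤ p * m := by nlinarith
      nlinarith
  · rintro ⟨rfl, h⟩
    linarith

/-- … and it is a numerator (extra zero) level iff `u ≤ R₀ − 2p` (`= −A`). -/
theorem numCov_bottom_iff (hp : 1 ≤ p) (hm : 1 ≤ m) (hu1 : -p ≤ u) :
    NumCov p m R0 (-1) u ↔ u ≤ R0 - 2 * p := by
  have e : dpos p m (-1) u = -(3 * (p * m) + u) := by unfold dpos; ring
  have hpm : p ≤ p * m := by nlinarith
  have pos : 0 ≤ 3 * (p * m) + u := by linarith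
  unfold NumCov
  rw [e, abs_neg, abs_of_nonneg pos]
  constructor <;> intro h <;> nlinarith

/-- lower zero frame `0 ≤ ℓ ≤ m−2` (so `m ≥ 2`): a block reaches level `ℓ` iff `ℓ = m−2` and `ρ ≥ 3p + u`; … -/
theorem blockCov_zeroLo_iff (hp : 1 ≤ p) (hρ : ρ ≤ R0 + p) (hR : R0 < 3 * p) (hu1 : -p ≤ u)
    (h0 : 0 ≤ ℓ) (h1 : ℓ ≤ m - 2) :
    BlockCov p m ρ ℓ u ↔ (ℓ = m - 2 ∧ 3 * p + u ≤ ρ) := by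
  have e : dpos p m ℓ u = 2 * (p * ℓ) - 3 * (p * m) + 2 * p - u := by unfold dpos; ring
  have hl0 : 0 ≤ p * ℓ := by nlinarith
  have hl1 : p * ℓ ≤ p * (m - 2) := mul_le_mul_of_nonneg_left h1 (by linarith)
  have neg : 2 * (p * ℓ) - 3 * (p * m) + 2 * p - u ≤ 0 := by nlinarith
  unfold BlockCov
  rw [e, abs_of_nonpos neg]
  constructor
  · intro h
    by_cases h2 : ℓ = m - 2
    · refine ⟨h2, ?_⟩
      subst h2
      nlinarith
    · have h3 : ℓ ≤ m - 3 := by omega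
      have : p * ℓ ≤ p * (m - 3) := mul_le_mul_of_nonneg_left h3 (by linarith)
      nlinarith
  · rintro ⟨rfl, h⟩
    nlinarith

/-- … and the numerator covers it unless `ℓ = 0` and `u > R₀` (A2 / «numerator-short»). -/
theorem numCov_zeroLo_iff (hp : 1 ≤ p) (hR0 : 0 ≤ R0) (hu1 : -p ≤ u) (hu2 : u ≤ p) (h0 : 0 ≤ ℓ) (h1 : ℓ ≤ m - 2) :
    NumCov p m R0 ℓ u ↔ (1 ≤ ℓ ∨ u ≤ R0) := by
  have e : dpos p m ℓ u = 2 * (p * ℓ) - 3 * (p * m) + 2 * p - u := by unfold dpos; ring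
  have hl0 : 0 ≤ p * ℓ := by nlinarith
  have hl1 : p * ℓ ≤ p * (m - 2) := mul_le_mul_of_nonneg_left h1 (by linarith)
  have neg : 2 * (p * ℓ) - 3 * (p * m) + 2 * p - u ≤ 0 := by nlinarith
  unfold NumCov
  rw [e, abs_of_nonpos neg]
  constructor
  · intro h
    by_cases h2 : 1 ≤ ℓ
    · exact Or.inl h2
    · right
      have h3 : ℓ = 0 := by omega
      subst h3
      nlinarith
  · rintro (h2 | h2)
    · have : p * 1 ≤ p * ℓ := mul_le_mul_of_nonneg_left h2 (by linarith)
      nlinarith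
    · nlinarith

/-- lower pole edge `ℓ = m−1` (`ζ = −m/2`): block `j` covers iff `u ≤ ρ_j − p` (`= −a_j`), i.e. MISSES iff `ρ_j < u + p`; … -/
theorem blockCov_lowEdge_iff (hp : 1 ≤ p) (hm : 1 ≤ m) (hu1 : -p ≤ u) :
    BlockCov p m ρ (m - 1) u ↔ u ≤ ρ - p := by
  have e : dpos p m (m - 1) u = -(p * m + u) := by unfold dpos; ring
  have hpm : p ≤ p * m := by nlinarith
  have pos : 0 ≤ p * m + u := by linarith
  unfold BlockCov
  rw [e, abs_neg, abs_of_nonneg pos]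
  constructor <;> intro h <;> nlinarith

/-- … the numerator covers it unless `m = 1` and `u > R₀` (A2). -/
theorem numCov_lowEdge_iff (hp : 1 ≤ p) (hR0 : 0 ≤ R0) (hm : 1 ≤ m) (hu1 : -p ≤ u) (hu2 : u ≤ p) :
    NumCov p m R0 (m - 1) u ↔ (2 ≤ m ∨ u ≤ R0) := by
  have e : dpos p m (m - 1) u = -(p * m + u) := by unfold dpos; ring
  have hpm : p ≤ p * m := by nlinarith
  have pos : 0 ≤ p * m + u := by linarith
  unfold NumCov
  rw [e, abs_neg, abs_of_nonneg pos]
  constructor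
  · intro h
    by_cases h2 : 2 ≤ m
    · exact Or.inl h2
    · right
      have h3 : m = 1 := by omega
      subst h3
      linarith
  · rintro (h2 | h2)
    · have : 2 * p ≤ p * m := by nlinarith
      nlinarith
    · nlinarith

/-- interior pole levels `m ≤ ℓ ≤ 2m−2`: every block and the numerator cover (this is exactly `ρ_j ≥ 0`). -/
theorem cov_interior (hp : 1 ≤ p) (hρ : 0 ≤ ρ) (hR0 : 0 ≤ R0) (hu1 : -p ≤ u) (hu2 : u ≤ p) (h0 : m ≤ ℓ) (h1 : ℓ ≤ 2 * m - 2) :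
    BlockCov p m ρ ℓ u ∧ NumCov p m R0 ℓ u := by
  have e : dpos p m ℓ u = 2 * (p * ℓ) - 3 * (p * m) + 2 * p - u := by unfold dpos; ring
  have hl0 : p * m ≤ p * ℓ := mul_le_mul_of_nonneg_left h0 (by linarith)
  have hl1 : p * ℓ ≤ p * (2 * m - 2) := mul_le_mul_of_nonneg_left h1 (by linarith)
  have hpm : p ≤ p * m := by nlinarith
  unfold BlockCov NumCov
  rw [e, abs_le, abs_le]
  refine ⟨⟨?_, ?_⟩, ?_, ?_⟩ <;> nlinarith

/-- upper pole edge `ℓ = 2m−1` (`ζ = +m/2`): block `j` covers iff `p − ρ_j ≤ u`, i.e. MISSES iff `ρ_j < p − u`; … -/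
theorem blockCov_highEdge_iff (hp : 1 ≤ p) (hm : 1 ≤ m) (hu2 : u ≤ p) :
    BlockCov p m ρ (2 * m - 1) u ↔ p - ρ ≤ u := by
  have := blockCov_lowEdge_iff (ρ := ρ) (u := -u) hp hm (by linarith)
  rw [show (2 * m - 1 : ℤ) = 3 * m - 2 - (m - 1) by ring, show u = - -u by ring, blockCov_mirror, this]
  constructor <;> intro h <;> linarith

/-- The upper pole-frame edge `ℓ = 2m − 1` is a numerator level iff `−((2m−2)p + R₀) ≤ u` (amendment A2, mirrored). -/
theorem numCov_highEdge_iff (hp : 1 ≤ p) (hR0 : 0 ≤ R0) (hm : 1 ≤ m) (hu1 : -p ≤ u) (hu2 : u ≤ p) :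
    NumCov p m R0 (2 * m - 1) u ↔ (2 ≤ m ∨ -R0 ≤ u) := by
  have := numCov_lowEdge_iff (R0 := R0) (u := -u) hp hR0 hm (by linarith) (by linarith)
  rw [show (2 * m - 1 : ℤ) = 3 * m - 2 - (m - 1) by ring, show u = - -u by ring, numCov_mirror, this]
  constructor <;> rintro (h | h) <;> first | exact Or.inl h | (right; linarith)

/-- top level `3m−1` (`ζ = +3m/2`): a block reaches it iff `m = 1` and `ρ ≥ 3p − u` (A1); numerator iff `u ≥ 2p − R₀ = A`. -/
theorem blockCov_top_iff (hp : 1 ≤ p) (hρ : ρ ≤ R0 + p) (hR : R0 < 3 * p) (hm : 1 ≤ m) (hu2 : u ≤ p) :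
    BlockCov p m ρ (3 * m - 1) u ↔ (m = 1 ∧ 3 * p - u ≤ ρ) := by
  have := blockCov_bottom_iff (ρ := ρ) (u := -u) hp hρ hR hm (by linarith)
  rw [show (3 * m - 1 : ℤ) = 3 * m - 2 - (-1) by ring, show u = - -u by ring, blockCov_mirror, this]
  simp only [neg_neg, sub_eq_add_neg]

/-- The top outer level `ℓ = 3m − 1` is never a numerator level. -/
theorem numCov_top_iff (hp : 1 ≤ p) (hm : 1 ≤ m) (hu2 : u ≤ p) :
    NumCov p m R0 (3 * m - 1) u ↔ 2 * p - R0 ≤ u := by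
  have := numCov_bottom_iff (R0 := R0) (u := -u) hp hm (by linarith)
  rw [show (3 * m - 1 : ℤ) = 3 * m - 2 - (-1) by ring, show u = - -u by ring, numCov_mirror, this]
  constructor <;> intro h <;> linarith

/-- upper zero frame `2m ≤ ℓ ≤ 3m−2`: a block reaches level `ℓ` iff `ℓ = 2m` and `ρ ≥ 3p − u`; numerator unless `ℓ = 3m−2 ∧ u < −R₀`. -/
theorem blockCov_zeroHi_iff (hp : 1 ≤ p) (hρ : ρ ≤ R0 + p) (hR : R0 < 3 * p) (hu2 : u ≤ p)
    (h0 : 2 * m ≤ ℓ) (h1 : ℓ ≤ 3 * m - 2) :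
    BlockCov p m ρ ℓ u ↔ (ℓ = 2 * m ∧ 3 * p - u ≤ ρ) := by
  have := blockCov_zeroLo_iff (m := m) (ρ := ρ) (ℓ := 3 * m - 2 - ℓ) (u := -u) hp hρ hR (by linarith)
    (by linarith) (by linarith)
  rw [show ℓ = 3 * m - 2 - (3 * m - 2 - ℓ) by ring, show u = - -u by ring, blockCov_mirror, this]
  constructor <;> rintro ⟨h2, h3⟩ <;> exact ⟨by linarith, by linarith⟩

/-- Upper zero-frame levels are numerator levels (`R₀ ≥ 0`). -/
theorem numCov_zeroHi_iff (hp : 1 ≤ p) (hR0 : 0 ≤ R0) (hu1 : -p ≤ u) (hu2 : u ≤ p) (h0 : 2 * m ≤ ℓ) (h1 : ℓ ≤ 3 * m - 2) :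
    NumCov p m R0 ℓ u ↔ (ℓ ≤ 3 * m - 3 ∨ -R0 ≤ u) := by
  have := numCov_zeroLo_iff (m := m) (R0 := R0) (ℓ := 3 * m - 2 - ℓ) (u := -u) hp hR0 (by linarith) (by linarith)
    (by linarith) (by linarith)
  rw [show ℓ = 3 * m - 2 - (3 * m - 2 - ℓ) by ring, show u = - -u by ring, numCov_mirror, this]
  constructor <;> rintro (h | h) <;> first | (left; linarith) | (right; linarith)

/-- above the frame (`ℓ ≥ 3m`) nothing covers. -/
theorem cov_above (hp : 1 ≤ p) (hR : R0 < 3 * p) (hρ : ρ ≤ R0 + p) (hm : 1 ≤ m) (hu2 : u ≤ p) (hℓ : 3 * m ≤ ℓ) :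
    ¬ BlockCov p m ρ ℓ u ∧ ¬ NumCov p m R0 ℓ u := by
  have := cov_below (m := m) (ρ := ρ) (ℓ := 3 * m - 2 - ℓ) (u := -u) hp hR hρ hm (by linarith) (by linarith)
  rwa [show ℓ = 3 * m - 2 - (3 * m - 2 - ℓ) by ring, show u = - -u by ring, blockCov_mirror, numCov_mirror]

end Criteria

end LevelModel

/-! ### The excess table, region by region -/

end Summit.KontsevichZagierPeriods.Zeta5Search.DenomLaw.ThresholdModel.Rho
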